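import Summits.Ventures.HodgeRepro2.T5RecordSatakeIntrinsic
import Summits.Ventures.HodgeRepro2.CyclotomicSeven

/-!
# A kernel instance of the hypothesis set of the record's spherical Hecke algebra: `ℚ(ζ₇)`, `H = diag(1, 1, −1)`

Tier-5 support N3 / §G-N4.2 (seat p3, gen 77). README §10.5 (ii)(c)/(d) asks that a hypothesis set be shown
inhabited on a concrete instance. Files 231–236 quantify over a CM field `K`, generators `l` of `𝓞_K` over
`𝓞_{K⁺}` (shown to exist in file 235) and a `3 × 3` hermitian invertible Gram matrix `H` over `K` with the
per-place condition `w ∉ badSet H`. This file exhibits the Gram matrix `H₀ = diag(1, 1, −1)` over ANY field with a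
star (`gramToy`): hermitian, `det = −1` a unit, `H₀⁻¹ = H₀`, and — every entry being `0` or `±1` — GOOD AT EVERY
FINITE PLACE (`notMem_badSet_gramToy : w ∉ badSet (gramToy L)`), so that the per-place hypothesis disappears; and
then reads the theorems of file 236 on it, and on the sextic Galois CM field of record `K7 = ℚ(ζ₇)` (seat p1's
`CyclotomicSeven.K7`, `isCMField_K7`):

* `gramToy_isHermitian`, `gramToy_det`, `isUnit_det_gramToy`, `gramToy_mul_gramToy`, `inv_gramToy`;
* `isInteger_gramToy_apply`, **`notMem_badSet_gramToy`** — `badSet (gramToy L) = ∅` (`badSet_gramToy`);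
* **`heckeAlgebra_mul_comm_record_gramToy_of_ramificationIdx'_eq_one`** — for every CM field `K`, generators `l`,
  and every `w ∣ v` with `e(w/v) = 1`: `H(U(1 ⊗ H₀), K_v)` is commutative (no other hypothesis);
* `nonempty_algEquiv_polynomial_record_gramToy_of_ramificationIdx'_eq_one` — `k[X]` when moreover `v` has one
  prime above it;
* `exists_finite_forall_heckeAlgebra_mul_comm_record_gramToy` — commutative at every `w ∣ v` outside a finite set;
* **`exists_generators_and_finite_forall_heckeAlgebra_mul_comm_record_K7`** — ON `ℚ(ζ₇)`: there are generators `l`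
  of `𝓞_{K7}` over `𝓞_{K7⁺}` and a finite set `Sv` of places of `K7⁺` with `H(U(1 ⊗ H₀), K_v)` commutative at every
  `w ∣ v ∉ Sv` — the whole hypothesis set of the N3 sentence instantiated on the field of record.

`H₀` is a Gram matrix of the right size and type (hermitian, invertible, good everywhere); the archimedean
signatures of the datum of record are the owner's and play no role at the finite places. §8(d): uses an
L-value-free non-vanishing device: NO.
-/

open Matrix NumberField NumberField.IsCMField IsDedekindDomain IsDedekindDomain.HeightOneSpectrum Module
open scoped TensorProduct Pointwise
open Summit.Ventures.HodgeRepro2.T5HeckePermutationModule Summit.Ventures.HodgeRepro2.T5RecordHyperspecial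
  Summit.Ventures.HodgeRepro2.T5GlobalLatticeAlmostAll Summit.Ventures.HodgeRepro2.T5FinitePlaceSplitClassification
  Summit.Ventures.HodgeRepro2.T5RecordSatakeIntrinsic Summit.Ventures.HodgeRepro2.T5CMFieldSquareDatum
  Summit.Ventures.HodgeRepro2.CyclotomicSeven

namespace Summit.Ventures.HodgeRepro2.T5RecordSatakeToy

section Gram

variable (L : Type*) [Field L]

/-- The toy Gram matrix `H₀ = diag(1, 1, −1)`. -/
def gramToy : Matrix (Fin 3) (Fin 3) L := Matrix.diagonal ![1, 1, -1]

variable {L}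

/-- `H₀` is hermitian for any star on `L`. -/
theorem gramToy_isHermitian [StarRing L] : (gramToy L).IsHermitian := by
  refine Matrix.ext fun i j => ?_
  fin_cases i <;> fin_cases j <;> simp [gramToy]

/-- `det H₀ = −1`. -/
theorem gramToy_det : (gramToy L).det = -1 := by
  simp [gramToy, Matrix.det_diagonal, Fin.prod_univ_succ]

/-- `det H₀` is a unit. -/
theorem isUnit_det_gramToy : IsUnit (gramToy L).det := by
  rw [gramToy_det]; exact isUnit_one.neg

/-- `H₀ · H₀ = 1`. -/
theorem gramToy_mul_gramToy : gramToy L * gramToy L = 1 := by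
  refine Matrix.ext fun i j => ?_
  fin_cases i <;> fin_cases j <;> simp [gramToy, Matrix.mul_apply, Fin.sum_univ_succ]

/-- `H₀⁻¹ = H₀`. -/
theorem inv_gramToy : (gramToy L)⁻¹ = gramToy L :=
  Matrix.inv_eq_left_inv gramToy_mul_gramToy

end Gram

section BadSet

variable {L : Type*} [Field L] [NumberField L]

/-- Every entry of `H₀` is `0`, `1` or `−1`. -/
theorem gramToy_apply_eq (i j : Fin 3) : gramToy L i j = 0 ∨ gramToy L i j = 1 ∨ gramToy L i j = -1 := by
  fin_cases i <;> fin_cases j <;> simp [gramToy]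

/-- Every entry of `H₀` is a local integer at every finite place. -/
theorem isInteger_gramToy_apply (w : HeightOneSpectrum (𝓞 L)) (i j : Fin 3) :
    IsLocalization.IsInteger (w.adicCompletionIntegers L) (algebraMap L (w.adicCompletion L) (gramToy L i j)) := by
  rcases gramToy_apply_eq (L := L) i j with h | h | h <;> rw [h]
  · rw [map_zero]; exact ⟨0, map_zero _⟩
  · rw [map_one]; exact ⟨1, map_one _⟩
  · rw [map_neg, map_one]; exact ⟨-1, by rw [map_neg, map_one]⟩

/-- **`H₀` is good at every finite place**: `w ∉ badSet (gramToy L)`. -/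
theorem notMem_badSet_gramToy (w : HeightOneSpectrum (𝓞 L)) : w ∉ badSet (gramToy L) := by
  rintro ⟨i, j, h | h⟩
  · exact h (isInteger_gramToy_apply w i j)
  · rw [inv_gramToy] at h
    exact h (isInteger_gramToy_apply w i j)

/-- `badSet (gramToy L) = ∅`. -/
theorem badSet_gramToy : badSet (gramToy L) = ∅ :=
  Set.eq_empty_of_forall_notMem notMem_badSet_gramToy

end BadSet

section Record

variable (K : Type*) [Field K] [NumberField K] [IsCMField K]
variable (v : HeightOneSpectrum (𝓞 (maximalRealSubfield K))) (w : HeightOneSpectrum (𝓞 K))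
  [w.asIdeal.LiesOver v.asIdeal]
variable {r : ℕ} (l : Fin r → 𝓞 K)

/-- **On `H₀`, at every unramified place**: for every CM field `K`, generators `l` and `w ∣ v` with `e(w/v) = 1`,
`H(U(1 ⊗ H₀), K_v)` is commutative — file 236's theorem with the goodness hypothesis discharged by
`notMem_badSet_gramToy`. -/
theorem heckeAlgebra_mul_comm_record_gramToy_of_ramificationIdx'_eq_one (k : Type*) [Field k]
    (hl : Submodule.span (𝓞 (maximalRealSubfield K)) (Set.range l) = ⊤)
    (he : v.asIdeal.ramificationIdx' w.asIdeal = 1)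
    (T S : (letI := tensorStarRing K v; ↥(heckeAlgebra k (recordHyperspecial K v l (gramToy K))))) :
    T * S = S * T :=
  heckeAlgebra_mul_comm_record_of_ramificationIdx'_eq_one K v w l k hl he gramToy_isHermitian isUnit_det_gramToy
    (notMem_badSet_gramToy w) T S

/-- **On `H₀`, `k[X]` at every unramified place with one prime above it.** -/
theorem nonempty_algEquiv_polynomial_record_gramToy_of_ramificationIdx'_eq_one (k : Type*) [Field k]
    (hl : Submodule.span (𝓞 (maximalRealSubfield K)) (Set.range l) = ⊤)
    (he : v.asIdeal.ramificationIdx' w.asIdeal = 1) (h1 : (v.asIdeal.primesOver (𝓞 K)).ncard = 1) :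
    Nonempty (Polynomial k ≃ₐ[k]
      (letI := tensorStarRing K v; ↥(heckeAlgebra k (recordHyperspecial K v l (gramToy K))))) :=
  nonempty_algEquiv_polynomial_record_of_ramificationIdx'_eq_one K v w l k hl he h1 gramToy_isHermitian
    isUnit_det_gramToy (notMem_badSet_gramToy w)

/-- **On `H₀`, at all but finitely many places.** -/
theorem exists_finite_forall_heckeAlgebra_mul_comm_record_gramToy (k : Type*) [Field k]
    (hl : Submodule.span (𝓞 (maximalRealSubfield K)) (Set.range l) = ⊤) :
    ∃ Sv : Set (HeightOneSpectrum (𝓞 (maximalRealSubfield K))), Sv.Finite ∧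
      ∀ v ∉ Sv, ∀ (w : HeightOneSpectrum (𝓞 K)) [w.asIdeal.LiesOver v.asIdeal],
        ∀ T S : (letI := tensorStarRing K v; ↥(heckeAlgebra k (recordHyperspecial K v l (gramToy K)))),
          T * S = S * T :=
  exists_finite_forall_heckeAlgebra_mul_comm_record K l k hl gramToy_isHermitian isUnit_det_gramToy

end Record

section SevenToy

/-- **THE HYPOTHESIS SET OF THE N3 SENTENCE IS INHABITED ON THE FIELD OF RECORD `ℚ(ζ₇)`**: with `H₀ = diag(1, 1, −1)`
there are generators `l` of `𝓞_{K7}` over `𝓞_{K7⁺}` and a finite set `Sv` of places of `K7⁺` such that the record's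
spherical Hecke algebra `H(U(1 ⊗ H₀), K_v)` is commutative at every `v ∉ Sv` and every place `w` of `K7` over `v`
(file 236's capstone on seat p1's `isCMField_K7`). -/
theorem exists_generators_and_finite_forall_heckeAlgebra_mul_comm_record_K7 (k : Type*) [Field k] :
    haveI := isCMField_K7
    ∃ (r : ℕ) (l : Fin r → 𝓞 K7), Submodule.span (𝓞 (maximalRealSubfield K7)) (Set.range l) = ⊤ ∧
      ∃ Sv : Set (HeightOneSpectrum (𝓞 (maximalRealSubfield K7))), Sv.Finite ∧
        ∀ v ∉ Sv, ∀ (w : HeightOneSpectrum (𝓞 K7)) [w.asIdeal.LiesOver v.asIdeal],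
          ∀ T S : (letI := tensorStarRing K7 v; ↥(heckeAlgebra k (recordHyperspecial K7 v l (gramToy K7)))),
            T * S = S * T :=
  haveI := isCMField_K7
  exists_generators_and_finite_forall_heckeAlgebra_mul_comm_record K7 k gramToy_isHermitian isUnit_det_gramToy

end SevenToy

end Summit.Ventures.HodgeRepro2.T5RecordSatakeToy
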